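import Literature.NumberTheory.EllipticCurves.CanonicalPAdicHeight
import Literature.NumberTheory.EllipticCurves.PadicPointsFiniteIndexProofs
import Literature.NumberTheory.EllipticCurves.TamagawaFiniteIndexProofs
import Literature.NumberTheory.EllipticCurves.ReductionHomomorphism
import Literature.NumberTheory.EllipticCurves.CanonicalPAdicHeightThetaProofs
import HarnessLib

/-!
# Admissible multiples over a number field: discharge of `exists_admissibleK_nsmul`

Trunk T-NT-EC (Literature/NumberTheory/EllipticCurves); proofs only, sibling of
`CanonicalPAdicHeight.lean`. DISCHARGES the named fact `WeierstrassCurve.exists_admissibleK_nsmul`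
(Silverman, *AEC*, VII.6.1/VII.6.2, VII.2.1, VII.2.2): for `E/ℚ` with Weierstrass equation `W`, a
number field `K` with `W ⊗ K` globally minimal, a prime `p` and a non-torsion `P ∈ E(K)`, some
multiple `mP`, `m ≥ 1`, is ADMISSIBLE (`WeierstrassCurve.IsAdmissibleK`): under every embedding
`ι : K → ℚ_p` it lies in `E₁` with `z = -x/y` in the disc of convergence of `σ_p`, and it has
non-singular reduction at every finite place `v` of `K`.

## The argument

Everything is reduced to FINITE-INDEX SUBGROUPS of `E(K) = (W ⊗ K)(K)`; `m` is the index of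
their (finite) intersection (`AddSubgroup.nsmul_index_mem`).
* Embeddings `ι : K → ℚ_p` (finitely many): pull back along Mathlib's `Point.map ι` the subgroup
  `E⁽²⁾(ℚ_p) = {P ∈ E₁(ℚ_p) : ‖z(P)‖ ≤ p⁻²}`, of finite index in `E(ℚ_p)` by the tree's
  `WeierstrassCurve.finiteIndex_formalFiltration` (AEC VII.6.3, `PadicPointsFiniteIndexProofs`);
  `p⁻² < p^{-1/(p-1)}` is the sigma disc (`WeierstrassCurve.exists_finiteIndex_padic`).
* Bad places (the finitely many `v ∣ Δ`): the kernel of reduction `E₁ = {O} ∪ {|x|_v > 1}`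
  (the tree's `WeierstrassCurve.kernelOfReduction`, AEC VII.2.1, `ReductionHomomorphism.lean`)
  has finite index in `E(K)` (`WeierstrassCurve.finiteIndex_kernelOfReduction`): the map sending
  `O` and `E₁` to one class and an integral point `(x, y)` to `(x, y) mod 𝔭ᴺ` (`𝓞_K/𝔭ᴺ` is
  finite; a `v`-integral element of `K` is congruent to an algebraic integer, Mathlib's
  `exists_valuation_sub_lt_of_integer`) has fibres inside cosets of `E₁`, because two integral
  points congruent modulo `𝔭ᴺ` with `|𝔭ᴺ| < |Δ|_v` differ by a point of `E₁` — the tree's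
  `WeierstrassCurve.Affine.one_lt_valuation_addX_of_near` (AEC Exercise 7.6) fed with the bound
  **`|Δ|_v ≤ max(|F_x(P)|_v, |F_y(P)|_v)`** at an integral point (`valuation_Δ_le_max_partial`:
  `Δ ∈ (a₃, a₄, a₆)` for the translate of the equation by the point). This replaces
  Kodaira–Néron (VII.6.1) / the compactness proof of Cor. VII.6.2 by one pigeonhole in `K`; no
  completion is used, and minimality of the equation is not needed (integrality suffices).
* Good places: the same bound with `|Δ|_v = 1` shows that EVERY integral point has a unit
  partial derivative, i.e. non-singular reduction (AEC VII.2, `Ẽ` non-singular).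

## Sources

* J. H. Silverman, *The Arithmetic of Elliptic Curves*, 2nd ed., GTM 106 (2009): VII.2
  Prop. 2.1 (PDF p. 167: `E₁(K) ⊆ E₀(K) ⊆ E(K)`), VII.6 Thm. 6.1 (Kodaira–Néron) and Cor. 6.2
  (PDF p. 177: `E₀(K)` has finite index), Exercise 7.6 (PDF p. 181), Prop. VII.6.3 (PDF p. 178),
  III.1.4 (`Δ = 0` iff singular). [`SilvermanAEC2009`]

## Design notes

* Curve statements are deliberate dot-notation extensions of Mathlib's `WeierstrassCurve`
  namespace (as the fact they discharge and the sibling proof files); generic lemmas are in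
  `Literature.NumberTheory.EllipticCurves`.
* The local statements for an arbitrary equation `V` over `K` with `v`-integral coefficients are
  proved after writing `V = W₀ ⊗ K` with `W₀` over the valuation ring of `v` (`subst`), so that
  the tree's `kernelOfReduction W₀` is literally a subgroup of `V(K)`.
-/

noncomputable section

open scoped Classical
open IsDedekindDomain NumberField

namespace Literature.NumberTheory.EllipticCurves

/-! ### Generic lemmas -/

/-- **Residues modulo `𝔭ᴺ` of `v`-integral elements.** For a finite place `v` of a number field
`K` and `N : ℕ` there is a map `ρ : K → 𝓞 K ⧸ 𝔭ᴺ` such that two `v`-INTEGRAL elements with the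
same image satisfy `|z - z'|_v ≤ |𝔭ᴺ|` (a `v`-integral `z ∈ K` is within `𝔭ᴺ` of an algebraic
integer `a`, Mathlib's `exists_valuation_sub_lt_of_integer`; `ρ z = a mod 𝔭ᴺ`, junk `0` off the
`v`-integers). [folklore] -/
theorem exists_residueMap_pow {K : Type*} [Field K] [NumberField K]
    (v : HeightOneSpectrum (𝓞 K)) (N : ℕ) :
    ∃ ρ : K → 𝓞 K ⧸ v.asIdeal ^ N, ∀ ⦃z z' : K⦄, v.valuation K z ≤ 1 → v.valuation K z' ≤ 1 →
      ρ z = ρ z' → v.valuation K (z - z') ≤ WithZero.exp (-(N : ℤ)) := by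
  let γ : (WithZero (Multiplicative ℤ))ˣ :=
    Units.mk0 (WithZero.exp (-(N : ℤ))) WithZero.coe_ne_zero
  have hγ : (γ : WithZero (Multiplicative ℤ)) = WithZero.exp (-(N : ℤ)) := rfl
  have happrox : ∀ z : K, v.valuation K z ≤ 1 →
      ∃ a : 𝓞 K, v.valuation K (algebraMap (𝓞 K) K a - z) < γ :=
    fun z hz => v.exists_valuation_sub_lt_of_integer hz γ
  refine ⟨fun z => if hz : v.valuation K z ≤ 1 then
    Ideal.Quotient.mk (v.asIdeal ^ N) (happrox z hz).choose else 0, ?_⟩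
  intro z z' hz hz' h
  dsimp only at h
  rw [dif_pos hz, dif_pos hz', Ideal.Quotient.eq] at h
  have ha := (happrox z hz).choose_spec
  have ha' := (happrox z' hz').choose_spec
  have h3 : v.valuation K (algebraMap (𝓞 K) K ((happrox z hz).choose - (happrox z' hz').choose))
      ≤ WithZero.exp (-(N : ℤ)) := by
    rw [HeightOneSpectrum.valuation_of_algebraMap, HeightOneSpectrum.intValuation_le_pow_iff_mem]
    exact h
  have e : z - z' = -(algebraMap (𝓞 K) K (happrox z hz).choose - z) +
      algebraMap (𝓞 K) K ((happrox z hz).choose - (happrox z' hz').choose) +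
      (algebraMap (𝓞 K) K (happrox z' hz').choose - z') := by
    rw [map_sub]; ring
  rw [e]
  refine (Valuation.map_add _ _ _).trans (max_le ((Valuation.map_add _ _ _).trans
    (max_le ?_ h3)) (hγ ▸ ha'.le))
  rw [Valuation.map_neg]; exact hγ ▸ ha.le

/-- A rational number which becomes an algebraic integer in a number field is an integer
(`ℤ` is integrally closed). [folklore] -/
theorem exists_int_cast_eq_of_algebraMap_eq {K : Type*} [Field K] [NumberField K] (q : ℚ)
    (r : 𝓞 K) (h : algebraMap ℚ K q = algebraMap (𝓞 K) K r) : ∃ n : ℤ, (n : ℚ) = q := by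
  have hint : IsIntegral ℤ (algebraMap ℚ K q) := h ▸ r.isIntegral_coe
  have hq : IsIntegral ℤ q := (isIntegral_algebraMap_iff (algebraMap ℚ K).injective).mp hint
  obtain ⟨n, hn⟩ := IsIntegrallyClosed.isIntegral_iff.mp hq
  exact ⟨n, by simpa using hn⟩

/-- `p⁻² < p^{-1/(p-1)}` for a prime `p` (the level-`2` filtration lies in the sigma disc).
[folklore] -/
theorem inv_sq_lt_rpow_sigmaDisc (p : ℕ) [hp : Fact p.Prime] :
    ((p : ℝ)⁻¹) ^ 2 < (p : ℝ) ^ (-(1 / ((p : ℝ) - 1))) := by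
  have hp2 : (2 : ℝ) ≤ p := by exact_mod_cast hp.out.two_le
  have hp1 : (1 : ℝ) < p := by linarith
  have e : ((p : ℝ)⁻¹) ^ 2 = (p : ℝ) ^ (-(2 : ℝ)) := by
    rw [Real.rpow_neg (by linarith), Real.rpow_two, inv_pow]
  rw [e, Real.rpow_lt_rpow_left_iff hp1, neg_lt_neg_iff, div_lt_iff₀ (by linarith)]
  linarith

end Literature.NumberTheory.EllipticCurves

namespace WeierstrassCurve

open Literature.NumberTheory.EllipticCurves

/-! ### `|Δ| ≤ max(|F_x(P)|, |F_y(P)|)` at an integral point (any valued field) -/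

section DiscriminantBound

variable {K : Type*} [Field K] {Γ₀ : Type*} [LinearOrderedCommGroupWithZero Γ₀]
  (v : Valuation K Γ₀) (V : WeierstrassCurve K)

/-- **`|Δ|_v ≤ max(|F_x(x, y)|_v, |F_y(x, y)|_v)` at a `v`-integral point of a `v`-integral
Weierstrass equation** (`F_x = a₁y - (3x² + 2a₂x + a₄)`, `F_y = 2y + a₁x + a₃` the partial
derivatives): translate the point to the origin (`(1, x, 0, y) • V`, Mathlib's
`equation_iff_variableChange`), so that the new `a₃, a₄, a₆` are `F_y`, `-F_x`, `0` and `Δ` is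
unchanged, and use `Δ ∈ (a₃, a₄, a₆)` (the tree's `Δ_eq_a₃_mul_add_a₄_mul_add_a₆_mul`). In
particular at a place of good reduction (`|Δ|_v = 1`) every integral point has a unit partial
derivative, i.e. non-singular reduction. The valuation-theoretic form of the tree's `p`-adic
`norm_Δ_le_max_partial`. [Silverman AEC III.1.4 (singular iff `Δ = 0`), VII.2] [folklore] -/
theorem valuation_Δ_le_max_partial (h₁ : v V.a₁ ≤ 1) (h₂ : v V.a₂ ≤ 1) (h₃ : v V.a₃ ≤ 1)
    (h₄ : v V.a₄ ≤ 1) (h₆ : v V.a₆ ≤ 1) {x y : K} (heq : V.toAffine.Equation x y)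
    (hx : v x ≤ 1) (hy : v y ≤ 1) :
    v V.Δ ≤ max (v (V.a₁ * y - (3 * x ^ 2 + 2 * V.a₂ * x + V.a₄)))
      (v (2 * y + V.a₁ * x + V.a₃)) := by
  have hv := Valuation.integer.integers v
  obtain ⟨W₀, hW₀⟩ : ∃ W₀ : WeierstrassCurve v.integer, W₀.baseChange K = V :=
    ⟨⟨⟨V.a₁, h₁⟩, ⟨V.a₂, h₂⟩, ⟨V.a₃, h₃⟩, ⟨V.a₄, h₄⟩, ⟨V.a₆, h₆⟩⟩, rfl⟩
  subst hW₀
  obtain ⟨X, rfl⟩ := hv.exists_of_le_one hx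
  obtain ⟨Y, rfl⟩ := hv.exists_of_le_one hy
  have heq' : W₀.toAffine.Equation X Y :=
    (Affine.map_equation (W := W₀.toAffine) (f := algebraMap v.integer K) hv.hom_inj X Y).mp heq
  set V' := (⟨1, X, 0, Y⟩ : VariableChange v.integer) • W₀ with hV'
  have hΔ : V'.Δ = W₀.Δ := by rw [hV', variableChange_Δ]; simp
  have ha₃ : V'.a₃ = 2 * Y + W₀.a₁ * X + W₀.a₃ := by
    rw [hV', variableChange_a₃]; simp only [inv_one, Units.val_one, one_pow, one_mul]; ring
  have ha₄ : V'.a₄ = -(W₀.a₁ * Y - (3 * X ^ 2 + 2 * W₀.a₂ * X + W₀.a₄)) := by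
    rw [hV', variableChange_a₄]; simp only [inv_one, Units.val_one, one_pow, one_mul]; ring
  have ha₆ : V'.a₆ = 0 := by
    have h := (Affine.equation_iff_variableChange X Y).mp heq'
    rw [Affine.equation_zero] at h
    rw [hV']; exact h
  have key := V'.Δ_eq_a₃_mul_add_a₄_mul_add_a₆_mul
  rw [ha₆, zero_mul, add_zero, hΔ] at key
  -- push everything to `K`
  set f := algebraMap v.integer K with hf
  have eΔ : (W₀.baseChange K).Δ = f W₀.Δ := by rw [baseChange, map_Δ]
  have eY : 2 * f Y + (W₀.baseChange K).a₁ * f X + (W₀.baseChange K).a₃ = f V'.a₃ := by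
    rw [ha₃]
    simp only [baseChange, map_a₁, map_a₃, hf, map_add, map_mul, map_ofNat]
  have eX : (W₀.baseChange K).a₁ * f Y - (3 * f X ^ 2 + 2 * (W₀.baseChange K).a₂ * f X +
      (W₀.baseChange K).a₄) = -f V'.a₄ := by
    rw [ha₄]
    simp only [baseChange, map_a₁, map_a₂, map_a₄, hf, map_add, map_mul, map_sub, map_neg,
      map_pow, map_ofNat, neg_neg]
  rw [eΔ, eY, eX, Valuation.map_neg, key, map_add, map_mul, map_mul]
  refine (v.map_add _ _).trans (max_comm (v (f V'.a₃)) _ ▸ max_le_max ?_ ?_)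
  · rw [map_mul]; exact mul_le_of_le_one_right' (hv.map_le_one _)
  · rw [map_mul]; exact mul_le_of_le_one_right' (hv.map_le_one _)

end DiscriminantBound

/-! ### The kernel of reduction has finite index in `E(K)` (finite place of a number field) -/

section KernelFiniteIndex

variable {K : Type*} [Field K] [NumberField K] (v : HeightOneSpectrum (𝓞 K))

/-- **`E₁` has finite index in `E(K)` at a finite place of a number field.** For a Weierstrass
equation `W₀` over a ring of `v`-integers `R` of `K` (`hv`) whose generic fibre is an elliptic
curve, the kernel of reduction `E₁ = {O} ∪ {(x, y) : |x|_v > 1}` (the tree's `kernelOfReduction`,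
a subgroup by AEC VII.2.1) has finite index in the group of `K`-points: send `O` and `E₁` to one
class and an integral point to `(x, y) mod 𝔭ᴺ` with `|𝔭ᴺ| < |Δ|_v` (`exists_residueMap_pow`;
`𝓞_K/𝔭ᴺ` is finite); fibres lie in cosets of `E₁` (`addSubgroup_finiteIndex_of_fibers`) since two
congruent integral points differ by a point of `E₁` (`Affine.one_lt_valuation_addX_of_near` with
`valuation_Δ_le_max_partial`). AEC proves `[E(K) : E₁(K)] < ∞` for complete `K` through
`E ⊇ E₀ ⊇ E₁` (Cor. VII.6.2 by Kodaira–Néron or compactness, and VII.2.1); here one pigeonhole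
in `K` itself. [Silverman AEC Cor. VII.6.2 (PDF p. 177), Exercise 7.6 (PDF p. 181), Prop. VII.2.1
(PDF p. 167)] [cite: SilvermanAEC2009, Cor. VII.6.2 (PDF p. 177) with Prop. VII.2.1 (PDF p. 167)] -/
theorem finiteIndex_kernelOfReduction {R : Type*} [CommRing R] [Algebra R K]
    (hv : (v.valuation K).Integers R) (W₀ : WeierstrassCurve R) [(W₀.baseChange K).IsElliptic] :
    (W₀.kernelOfReduction hv).FiniteIndex := by
  set w := v.valuation K with hw
  set V := W₀.baseChange K with hV
  have ha₁ : w V.a₁ ≤ 1 := hv.map_le_one W₀.a₁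
  have ha₂ : w V.a₂ ≤ 1 := hv.map_le_one W₀.a₂
  have ha₃ : w V.a₃ ≤ 1 := hv.map_le_one W₀.a₃
  have ha₄ : w V.a₄ ≤ 1 := hv.map_le_one W₀.a₄
  have ha₆ : w V.a₆ ≤ 1 := hv.map_le_one W₀.a₆
  have hΔne : V.Δ ≠ 0 := V.coe_Δ' ▸ V.Δ'.ne_zero
  obtain ⟨N, hN⟩ := WithZero.exists_exp_neg_natCast_lt ((Valuation.ne_zero_iff w).mpr hΔne)
  obtain ⟨ρ, hρ⟩ := exists_residueMap_pow v N
  haveI : Finite (𝓞 K ⧸ v.asIdeal ^ N) :=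
    Ideal.finiteQuotientOfFreeOfNeBot _ (pow_ne_zero N v.ne_bot)
  have hE₁ : ∀ {x y : K} (h : V.toAffine.Nonsingular x y), 1 < w x →
      (Affine.Point.some x y h : V.toAffine.Point) ∈ W₀.kernelOfReduction hv :=
    fun h hx => (mem_kernelOfReduction_iff hv).mpr
      ((reducesToZero_some_iff h).mpr ((not_mem_range_iff hv).mpr hx))
  let Φ : V.toAffine.Point → Option ((𝓞 K ⧸ v.asIdeal ^ N) × (𝓞 K ⧸ v.asIdeal ^ N)) :=
    fun P => match P with
    | .zero => none
    | .some x y _ => if 1 < w x then none else some (ρ x, ρ y)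
  refine addSubgroup_finiteIndex_of_fibers _ Φ fun P Q hPQ => ?_
  rcases P with _ | ⟨x₁, y₁, h₁⟩ <;> rcases Q with _ | ⟨x₂, y₂, h₂⟩
  · rw [sub_self]; exact zero_mem _
  · by_cases hx₂ : 1 < w x₂
    · rw [← Affine.Point.zero_def, zero_sub]; exact neg_mem (hE₁ h₂ hx₂)
    · exfalso; simp [Φ, hx₂] at hPQ
  · by_cases hx₁ : 1 < w x₁
    · rw [← Affine.Point.zero_def, sub_zero]; exact hE₁ h₁ hx₁
    · exfalso; simp [Φ, hx₁] at hPQ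
  · by_cases hx₁ : 1 < w x₁ <;> by_cases hx₂ : 1 < w x₂
    · exact sub_mem (hE₁ h₁ hx₁) (hE₁ h₂ hx₂)
    · exfalso; simp [Φ, hx₁, hx₂] at hPQ
    · exfalso; simp [Φ, hx₁, hx₂] at hPQ
    · have hx₁' : w x₁ ≤ 1 := not_lt.mp hx₁
      have hx₂' : w x₂ ≤ 1 := not_lt.mp hx₂
      have hy₁ : w y₁ ≤ 1 := Affine.valuation_y_le_one w ha₁ ha₂ ha₃ ha₄ ha₆ h₁.1 hx₁'
      have hy₂ : w y₂ ≤ 1 := Affine.valuation_y_le_one w ha₁ ha₂ ha₃ ha₄ ha₆ h₂.1 hx₂'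
      simp only [Φ, if_neg hx₁, if_neg hx₂, Option.some.injEq, Prod.mk.injEq] at hPQ
      have hdx : w (x₁ - x₂) < w V.Δ := (hρ hx₁' hx₂' hPQ.1).trans_lt hN
      have hdy : w (y₁ - y₂) < w V.Δ := (hρ hy₁ hy₂ hPQ.2).trans_lt hN
      by_cases hne : x₁ = x₂ ∧ y₁ = y₂
      · obtain ⟨rfl, rfl⟩ := hne
        rw [sub_self]; exact zero_mem _
      · have hδ := V.valuation_Δ_le_max_partial w ha₁ ha₂ ha₃ ha₄ ha₆ h₂.1 hx₂' hy₂
        have key :=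
          Affine.one_lt_valuation_addX_of_near w ha₁ ha₂ h₂.1 h₁.1 hx₂' hx₁' hδ hdx hdy hne
        rw [sub_eq_add_neg, Affine.Point.neg_some,
          Affine.Point.add_some fun h => hne ⟨h.1, h.2.trans (Affine.negY_negY _ _)⟩]
        exact hE₁ _ key

/-- **A finite-index subgroup of `E(K)` inside `E₁` at `v`**, for any Weierstrass equation `V` of
an elliptic curve over the number field `K` with `v`-integral coefficients: some subgroup of finite
index consists of `O` and points with `|x|_v > 1` (namely `E₁`, `finiteIndex_kernelOfReduction`,
after writing `V = W₀ ⊗ K` over the valuation ring).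
[cite: SilvermanAEC2009, Cor. VII.6.2 (PDF p. 177) with Prop. VII.2.1 (PDF p. 167)] -/
theorem exists_finiteIndex_one_lt_valuation (V : WeierstrassCurve K) [V.IsElliptic]
    (h₁ : v.valuation K V.a₁ ≤ 1) (h₂ : v.valuation K V.a₂ ≤ 1) (h₃ : v.valuation K V.a₃ ≤ 1)
    (h₄ : v.valuation K V.a₄ ≤ 1) (h₆ : v.valuation K V.a₆ ≤ 1) :
    ∃ H : AddSubgroup V.toAffine.Point, H.FiniteIndex ∧
      ∀ ⦃x y : K⦄ (h : V.toAffine.Nonsingular x y), Affine.Point.some x y h ∈ H →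
        1 < v.valuation K x := by
  obtain ⟨W₀, hW₀⟩ : ∃ W₀ : WeierstrassCurve (v.valuation K).integer, W₀.baseChange K = V :=
    ⟨⟨⟨V.a₁, h₁⟩, ⟨V.a₂, h₂⟩, ⟨V.a₃, h₃⟩, ⟨V.a₄, h₄⟩, ⟨V.a₆, h₆⟩⟩, rfl⟩
  subst hW₀
  have hv := Valuation.integer.integers (v.valuation K)
  refine ⟨W₀.kernelOfReduction hv, finiteIndex_kernelOfReduction v hv W₀, fun x y h hmem => ?_⟩
  exact (not_mem_range_iff hv).mp
    ((reducesToZero_some_iff h).mp ((mem_kernelOfReduction_iff hv).mp hmem))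

end KernelFiniteIndex

/-! ### Embeddings `K → ℚ_p`: pulling back `E⁽²⁾(ℚ_p)` -/

section Padic

variable (W : WeierstrassCurve ℚ) [W.IsElliptic] [W.IsIntegral ℤ] (K : Type*) [Field K]
  [NumberField K] (p : ℕ) [Fact p.Prime]

/-- **A finite-index subgroup of `E(K)` mapping into `E⁽²⁾(ℚ_p)` under `ι : K → ℚ_p`**: the
pull-back along Mathlib's `Point.map ι : E(K) → E(ℚ_p)` of
`E⁽²⁾(ℚ_p) = {P ∈ E₁(ℚ_p) : ‖z(P)‖ ≤ p⁻²}`, which has finite index in `E(ℚ_p)` (the tree's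
`finiteIndex_formalFiltration`, AEC VII.6.3); its points `(x, y)` have `‖ι x‖ > 1` and
`‖ι x / ι y‖ ≤ p⁻²`. (`W` with integer coefficients, so that `W ⊗ ℚ_p` is `ℤ_p`-integral.)
[cite: SilvermanAEC2009, Prop. VII.6.3 (PDF p. 178)] -/
theorem exists_finiteIndex_padic (ι : K →+* ℚ_[p]) :
    ∃ H : AddSubgroup (W.baseChange K).toAffine.Point, H.FiniteIndex ∧
      ∀ ⦃x y : K⦄ (h : (W.baseChange K).toAffine.Nonsingular x y),
        Affine.Point.some x y h ∈ H → 1 < ‖ι x‖ ∧ ‖-ι x / ι y‖ ≤ ((p : ℝ)⁻¹) ^ 2 := by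
  haveI : (W.baseChange ℚ_[p]).IsElliptic := by rw [baseChange]; infer_instance
  set f : (W.baseChange K).toAffine.Point →+ (W.baseChange ℚ_[p]).toAffine.Point :=
    Affine.Point.map (W' := W.toAffine) (S := ℚ) ι.toRatAlgHom with hf
  set F := (W.baseChange ℚ_[p]).formalFiltration 2 with hF
  haveI hFi : F.FiniteIndex := (W.baseChange ℚ_[p]).finiteIndex_formalFiltration 2
  haveI : Finite ((W.baseChange ℚ_[p]).toAffine.Point ⧸ F) :=
    AddSubgroup.finite_quotient_of_finiteIndex
  refine ⟨F.comap f, ?_, fun x y h hmem => ?_⟩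
  · refine addSubgroup_finiteIndex_of_fibers _ (fun P => (QuotientAddGroup.mk (f P) : _ ⧸ F))
      fun P Q hPQ => ?_
    rw [AddSubgroup.mem_comap, map_sub]
    exact QuotientAddGroup.eq_iff_sub_mem.mp hPQ
  · rw [AddSubgroup.mem_comap, hf, Affine.Point.map_some, hF, mem_formalFiltration_iff,
      isInReductionKernel_some, formalParameter_some] at hmem
    exact hmem

end Padic

/-! ### Assembly -/

section Assembly

/-- An equation over `ℚ` whose base change to a number field `K` has coefficients in `𝓞 K` has
integer coefficients. [folklore] -/
theorem isIntegral_int_of_isIntegral_baseChange (W : WeierstrassCurve ℚ) (K : Type*) [Field K]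
    [NumberField K] [hW : (W.baseChange K).IsIntegral (𝓞 K)] : W.IsIntegral ℤ := by
  obtain ⟨V, hV⟩ := hW.integral
  have e : ∀ {q : ℚ} {r : 𝓞 K}, algebraMap ℚ K q = algebraMap (𝓞 K) K r →
      ∃ n : ℤ, algebraMap ℤ ℚ n = q := fun {q r} hq => by
    obtain ⟨n, hn⟩ := exists_int_cast_eq_of_algebraMap_eq q r hq
    exact ⟨n, by simpa using hn⟩
  have h1 := congrArg WeierstrassCurve.a₁ hV
  have h2 := congrArg WeierstrassCurve.a₂ hV
  have h3 := congrArg WeierstrassCurve.a₃ hV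
  have h4 := congrArg WeierstrassCurve.a₄ hV
  have h6 := congrArg WeierstrassCurve.a₆ hV
  simp only [baseChange, map_a₁, map_a₂, map_a₃, map_a₄, map_a₆] at h1 h2 h3 h4 h6
  exact isIntegral_of_exists_lift ℤ (e h1) (e h2) (e h3) (e h4) (e h6)

/-- **Discharge of `WeierstrassCurve.exists_admissibleK_nsmul`** (admissible multiples over a
number field): for `E/ℚ`, `K` a number field with `W ⊗ K` globally minimal, `p` prime and
`P ∈ E(K)` of infinite order, some `mP` (`m ≥ 1`) is admissible — `m` is the index of the
intersection of the finite-index subgroups of `exists_finiteIndex_padic` (one per embedding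
`K → ℚ_p`) and `exists_finiteIndex_one_lt_valuation` (one per place dividing `Δ`); at the places
not dividing `Δ` non-singular reduction is automatic (`valuation_Δ_le_max_partial`). Only the
integrality of `W ⊗ K` is used. [Silverman AEC VII.6.1/VII.6.2 (`E/E₀` finite), VII.2.1
(`E₀ ⊇ E₁`), VII.2.2 & IV.3.2 (`E₁ ⊇ E₂ ⊇ ⋯` of finite index), VII.6.3]
[cite: SilvermanAEC2009, Cor. VII.6.2 (PDF p. 177), Prop. VII.2.1 (p. 167), VII.6.3 (p. 178)] -/
theorem exists_admissibleK_nsmul_holds : exists_admissibleK_nsmul := by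
  intro W _ K _ _ _ p _ P hP
  haveI : W.IsIntegral ℤ := isIntegral_int_of_isIntegral_baseChange W K
  haveI : (W.baseChange K).IsElliptic := by rw [baseChange]; infer_instance
  -- the coefficients of `W ⊗ K` are algebraic integers
  obtain ⟨Wz, hWz⟩ := (inferInstance : W.IsIntegral ℤ).integral
  have hcoe : ∀ n : ℤ, algebraMap ℚ K (algebraMap ℤ ℚ n) = algebraMap (𝓞 K) K n := by simp
  have hc : ∀ u : HeightOneSpectrum (𝓞 K), u.valuation K (W.baseChange K).a₁ ≤ 1 ∧
      u.valuation K (W.baseChange K).a₂ ≤ 1 ∧ u.valuation K (W.baseChange K).a₃ ≤ 1 ∧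
      u.valuation K (W.baseChange K).a₄ ≤ 1 ∧ u.valuation K (W.baseChange K).a₆ ≤ 1 := by
    intro u
    simp only [hWz, baseChange, map_a₁, map_a₂, map_a₃, map_a₄, map_a₆, hcoe]
    exact ⟨u.valuation_le_one _, u.valuation_le_one _, u.valuation_le_one _,
      u.valuation_le_one _, u.valuation_le_one _⟩
  -- the bad places
  obtain ⟨D, hD⟩ : ∃ D : 𝓞 K, algebraMap (𝓞 K) K D = (W.baseChange K).Δ :=
    Δ_integral_of_isIntegral (𝓞 K) (W.baseChange K)
  have hD0 : D ≠ 0 := by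
    rintro rfl
    rw [map_zero] at hD
    exact ((W.baseChange K).coe_Δ' ▸ (W.baseChange K).Δ'.ne_zero) hD.symm
  set S := {u : HeightOneSpectrum (𝓞 K) | u.asIdeal ∣ Ideal.span {D}} with hS
  haveI : Finite S :=
    (Ideal.finite_factors (by simpa [Ideal.span_singleton_eq_bot] using hD0)).to_subtype
  -- the subgroups
  choose Hι hHι hHι' using fun ι : K →+* ℚ_[p] => exists_finiteIndex_padic W K p ι
  choose Hv hHv hHv' using fun u : HeightOneSpectrum (𝓞 K) =>
    exists_finiteIndex_one_lt_valuation u (W.baseChange K) (hc u).1 (hc u).2.1 (hc u).2.2.1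
      (hc u).2.2.2.1 (hc u).2.2.2.2
  set H : AddSubgroup (W.baseChange K).toAffine.Point := (⨅ ι, Hι ι) ⊓ ⨅ u : S, Hv u with hH
  haveI : (⨅ ι, Hι ι).FiniteIndex := AddSubgroup.finiteIndex_iInf hHι
  haveI : (⨅ u : S, Hv u).FiniteIndex := AddSubgroup.finiteIndex_iInf fun u => hHv u
  haveI hHfin : H.FiniteIndex := by rw [hH]; infer_instance
  have hm : H.index ≠ 0 := hHfin.index_ne_zero
  -- the local conditions at a point of `H` other than `O`
  have key : ∀ Q : (W.baseChange K).toAffine.Point, Q ∈ H → Q ≠ 0 →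
      W.SatisfiesLocalConditionsK p K Q := by
    intro Q hQ hQ0
    rcases Q with _ | ⟨x, y, h⟩
    · exact (hQ0 rfl).elim
    refine ⟨fun ι => ?_, fun u => ?_⟩
    · have hι := hHι' ι h (AddSubgroup.mem_iInf.mp (AddSubgroup.mem_inf.mp hQ).1 ι)
      exact ⟨hι.1, hι.2.trans_lt (inv_sq_lt_rpow_sigmaDisc p)⟩
    by_cases hu : u ∈ S
    · exact Or.inl (hHv' u h (AddSubgroup.mem_iInf.mp (AddSubgroup.mem_inf.mp hQ).2 ⟨u, hu⟩))
    by_cases hx : 1 < u.valuation K x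
    · exact Or.inl hx
    -- a good place: every integral point has a unit partial derivative
    obtain ⟨h₁, h₂, h₃, h₄, h₆⟩ := hc u
    have hx' : u.valuation K x ≤ 1 := not_lt.mp hx
    have hy' : u.valuation K y ≤ 1 :=
      Affine.valuation_y_le_one (u.valuation K) h₁ h₂ h₃ h₄ h₆ h.1 hx'
    have hΔ1 : u.valuation K (W.baseChange K).Δ = 1 := by
      rw [← hD, HeightOneSpectrum.valuation_of_algebraMap,
        HeightOneSpectrum.intValuation_eq_one_iff_mem_primeCompl]
      exact fun hmemD => hu (Ideal.dvd_span_singleton.mpr hmemD)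
    have hb := (W.baseChange K).valuation_Δ_le_max_partial (u.valuation K) h₁ h₂ h₃ h₄ h₆ h.1
      hx' hy'
    rw [hΔ1, le_max_iff] at hb
    have n2 : u.valuation K (2 : K) ≤ 1 := by
      rw [show (2 : K) = 1 + 1 by norm_num]; exact Valuation.map_add_le _ (by simp) (by simp)
    have n3 : u.valuation K (3 : K) ≤ 1 := by
      rw [show (3 : K) = 2 + 1 by norm_num]; exact Valuation.map_add_le _ n2 (by simp)
    have hFx : u.valuation K ((W.baseChange K).a₁ * y -
        (3 * x ^ 2 + 2 * (W.baseChange K).a₂ * x + (W.baseChange K).a₄)) ≤ 1 := by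
      refine Valuation.map_sub_le _ ?_
        (Valuation.map_add_le _ (Valuation.map_add_le _ ?_ ?_) h₄)
      · rw [map_mul]; exact mul_le_one' h₁ hy'
      · rw [map_mul, map_pow]; exact mul_le_one' n3 (pow_le_one' hx' 2)
      · rw [map_mul, map_mul]; exact mul_le_one' (mul_le_one' n2 h₂) hx'
    have hFy : u.valuation K (2 * y + (W.baseChange K).a₁ * x + (W.baseChange K).a₃) ≤ 1 := by
      refine Valuation.map_add_le _ (Valuation.map_add_le _ ?_ ?_) h₃
      · rw [map_mul]; exact mul_le_one' n2 hy'
      · rw [map_mul]; exact mul_le_one' h₁ hx'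
    right
    rw [Affine.evalEval_polynomialX, Affine.evalEval_polynomialY]
    rcases hb with hX | hY
    · exact Or.inl (le_antisymm hFx hX)
    · exact Or.inr (le_antisymm hFy hY)
  refine ⟨H.index, hm, fun h => hP (h.of_nsmul hm), key _ (H.nsmul_index_mem P) fun h0 => hP ?_⟩
  have : IsOfFinAddOrder (H.index • P) := by rw [h0]; exact IsOfFinAddOrder.zero
  exact this.of_nsmul hm

end Assembly

end WeierstrassCurve
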